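import Summits.CriticalPhenomena.SAWScalingLimit.Theorems.SAWRenewalTightnessTubeLowerBoundProfilePotentialDefs
import Summits.CriticalPhenomena.SAWScalingLimit.Theorems.SAWRenewalTightnessTubeLowerBoundHardness
import Summits.CriticalPhenomena.SAWScalingLimit.Theorems.AnnularMassDecay.Negative.HalfPlaneDivergence
import Mathlib.Analysis.SpecialFunctions.Pow.Real

/-!
# Crux `TubeLowerBound` (stmt-CriticalPhenomena-4730), line `profile-potential`:
# stub `stub_spanFloor_of_halfPlaneCut`

The by-product DOOR of the line: from

1. the half-plane first-exit cut `HalfPlaneCut` (stub S5 of the line, a hypothesis here):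
   `h̃_n ≤ sl_n + Σ_{k≤n} w_k h̃^{(R+1)}_{n−k}` with `h̃^{(t)}_n = #hpWalks t n`,
   `sl_n = #slabWalks R n`, `w_k = #wallBridges R k`;
2. slab subcriticality `SlabSubcritical` (print hypothesis; Madras–Slade 1993, Thm 7.2.3 and
   (8.2.11)): `Σ_{n≤N} sl_n x_c^n ≤ S(R)` for all `N`;
3. the half-plane profile bound `HalfPlaneProfileBound` (OPEN hypothesis): for `N ≥ N₀(t)`,
   `Σ_{n≤N} h̃^{(t)}_n x_c^n ≤ A (t+1)^C Σ_{n≤N} h̃_n x_c^n`, `A ≥ 1`, `C ≥ 0`,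

we derive Kesten's span-renewal floor `SpanRenewalFloor` with the same exponent `C` and the constant
`c := x_c / (2A)`:  for every `L ≥ 1` some partial sum of the `x_c`-mass of the bridges of
`Zd.bridges 2 n` ending on the column `x = L` is `≥ c L^{−C}`.

Proof (pure finite-sum calculus plus two small SAW facts):
* summing the cut with weights `x_c^n = x_c^k x_c^{n−k}` and exchanging the triangular sum
  (`SpanFloorOfHalfPlaneCutProof.tri_sum_le`) gives `H_N ≤ SL_N + W_N H'_N`
  (`SpanFloorOfHalfPlaneCutProof.hpSum_le`);
* the half-space walks of Madras–Slade (Definition 3.1.2) are weak half-plane walks from depth `0`,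
  so the tree's divergence `AnnularMassDecay.Negative.halfPlanePartialSum_unbounded` (Madras–Slade
  Corollary 3.1.8) makes `H_N` unbounded (`SpanFloorOfHalfPlaneCutProof.hpSum_unbounded`);
* with `N` large, `H_N ≥ 2S + 2` and `H'_N ≤ A L^C H_N` give `1 ≤ 2 A L^C W_N`
  (`SpanFloorOfHalfPlaneCutProof.wallSum_floor`);
* prepending one east step (the tree's `LiebSimonStar.Hardness.pre_mem_saws` / `pre_isBridge` /
  `pre_injective`) maps `wallBridges R k` injectively into the bridges of `Zd.bridges 2 (k+1)`
  ending on `x = R + 2` (`SpanFloorOfHalfPlaneCutProof.card_wallBridges_le`), whence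
  `x_c W_N ≤ Σ_{n≤N+1} Σ_{bridges of span R+2} x_c^n`
  (`SpanFloorOfHalfPlaneCutProof.mul_wallSum_le_bridgeSum`);
* `L = 1` is witnessed by the one-step straight walk (the tree's
  `LiebSimonStar.Hardness.criticalFugacity_le_bridgeMass_one`).

Sources: H. Kesten, J. Math. Phys. 4 (1963) (span renewal of bridges); N. Madras, G. Slade,
*The Self-Avoiding Walk* (1993), §1.2, §3.1, Thm 7.2.3; B. Simon, Comm. Math. Phys. 77 (1980);
E. Lieb, Comm. Math. Phys. 77 (1980) (the first-exit cut).
-/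

noncomputable section

namespace Summit.CriticalPhenomena.SAWScalingLimit.Theorems.TubeLowerBound.ProfilePotential

open scoped BigOperators Classical
open Literature.Probability.LatticeModels
open Literature.Probability.RandomPlanarGeometry Literature.Probability.RandomPlanarGeometry.SAW

namespace SpanFloorOfHalfPlaneCutProof

/-! ### Finite-sum calculus: the summed cut

Notation of the docstrings: `H^{(t)}_N = Σ_{n ≤ N} #hpWalks t n · x_c^n` (`H_N = H^{(0)}_N`),
`SL_N = Σ_{n ≤ N} #slabWalks R n · x_c^n`, `W_N = Σ_{k ≤ N} #wallBridges R k · x_c^k`; all sums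
are written out (no auxiliary definitions). -/

/-- Exchange of a triangular double sum against a product of partial sums (nonnegative terms):
`Σ_{n ≤ M} Σ_{m ≤ n} F m G (n-m) ≤ (Σ_{j ≤ M} F j) (Σ_{k ≤ M} G k)`. -/
theorem tri_sum_le (F G : ℕ → ℝ) (hF : ∀ n, 0 ≤ F n) (hG : ∀ n, 0 ≤ G n) (M : ℕ) :
    ∑ n ∈ Finset.range (M + 1), ∑ m ∈ Finset.range (n + 1), F m * G (n - m) ≤
      (∑ j ∈ Finset.range (M + 1), F j) * ∑ k ∈ Finset.range (M + 1), G k := by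
  have hswap : ∑ n ∈ Finset.range (M + 1), ∑ m ∈ Finset.range (n + 1), F m * G (n - m) =
      ∑ m ∈ Finset.range (M + 1), ∑ n ∈ Finset.Ico m (M + 1), F m * G (n - m) := by
    refine Finset.sum_comm' fun n m => ?_
    simp only [Finset.mem_range, Finset.mem_Ico]
    omega
  rw [hswap, Finset.sum_mul]
  refine Finset.sum_le_sum fun m _ => ?_
  rw [Finset.sum_Ico_eq_sum_range, ← Finset.mul_sum]
  refine mul_le_mul_of_nonneg_left ?_ (hF m)
  calc ∑ k ∈ Finset.range (M + 1 - m), G (m + k - m)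
      = ∑ k ∈ Finset.range (M + 1 - m), G k :=
        Finset.sum_congr rfl fun k _ => by rw [Nat.add_sub_cancel_left]
    _ ≤ ∑ k ∈ Finset.range (M + 1), G k :=
        Finset.sum_le_sum_of_subset_of_nonneg (Finset.range_mono (Nat.sub_le _ _))
          fun k _ _ => hG k

/-- **The summed cut**: multiplying `HalfPlaneCut` by `x_c^n = x_c^k x_c^{n-k}`, summing over
`n ≤ N` and exchanging the triangular sum gives `H_N ≤ SL_N + W_N · H^{(R+1)}_N`. -/
theorem hpSum_le (hcut : HalfPlaneCut) (R N : ℕ) :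
    ∑ n ∈ Finset.range (N + 1), ((hpWalks 0 n).card : ℝ) * criticalFugacity ^ n ≤
      ∑ n ∈ Finset.range (N + 1), ((slabWalks R n).card : ℝ) * criticalFugacity ^ n +
        (∑ k ∈ Finset.range (N + 1), ((wallBridges R k).card : ℝ) * criticalFugacity ^ k) *
          ∑ n ∈ Finset.range (N + 1), ((hpWalks (R + 1) n).card : ℝ) * criticalFugacity ^ n := by
  have hx : 0 ≤ criticalFugacity := criticalFugacity_pos.le
  obtain ⟨F, hF⟩ : ∃ F : ℕ → ℝ,
      F = fun k => ((wallBridges R k).card : ℝ) * criticalFugacity ^ k := ⟨_, rfl⟩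
  obtain ⟨G, hG⟩ : ∃ G : ℕ → ℝ,
      G = fun m => ((hpWalks (R + 1) m).card : ℝ) * criticalFugacity ^ m := ⟨_, rfl⟩
  have hF0 : ∀ k, 0 ≤ F k := fun k => by
    rw [hF]; exact mul_nonneg (Nat.cast_nonneg _) (pow_nonneg hx k)
  have hG0 : ∀ m, 0 ≤ G m := fun m => by
    rw [hG]; exact mul_nonneg (Nat.cast_nonneg _) (pow_nonneg hx m)
  have hterm : ∀ n, ((hpWalks 0 n).card : ℝ) * criticalFugacity ^ n ≤
      ((slabWalks R n).card : ℝ) * criticalFugacity ^ n +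
        ∑ k ∈ Finset.range (n + 1), F k * G (n - k) := by
    intro n
    have h := mul_le_mul_of_nonneg_right (hcut R n) (pow_nonneg hx n)
    rw [add_mul, Finset.sum_mul] at h
    refine h.trans (add_le_add le_rfl (le_of_eq (Finset.sum_congr rfl fun k hk => ?_)))
    rw [Finset.mem_range] at hk
    rw [hF, hG]
    have hpow : criticalFugacity ^ n = criticalFugacity ^ k * criticalFugacity ^ (n - k) := by
      rw [← pow_add, Nat.add_sub_cancel' (Nat.lt_succ_iff.mp hk)]
    rw [hpow]
    ring
  calc ∑ n ∈ Finset.range (N + 1), ((hpWalks 0 n).card : ℝ) * criticalFugacity ^ n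
      ≤ ∑ n ∈ Finset.range (N + 1), (((slabWalks R n).card : ℝ) * criticalFugacity ^ n +
          ∑ k ∈ Finset.range (n + 1), F k * G (n - k)) := Finset.sum_le_sum fun n _ => hterm n
    _ = ∑ n ∈ Finset.range (N + 1), ((slabWalks R n).card : ℝ) * criticalFugacity ^ n +
          ∑ n ∈ Finset.range (N + 1), ∑ k ∈ Finset.range (n + 1), F k * G (n - k) := by
          rw [Finset.sum_add_distrib]
    _ ≤ ∑ n ∈ Finset.range (N + 1), ((slabWalks R n).card : ℝ) * criticalFugacity ^ n +
          (∑ k ∈ Finset.range (N + 1), F k) * ∑ m ∈ Finset.range (N + 1), G m :=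
          add_le_add le_rfl (tri_sum_le F G hF0 hG0 N)
    _ = _ := by rw [hF, hG]

/-! ### Divergence of the weak half-plane partial sums -/

/-- The half-space walks of Madras–Slade (`x₁(0) < x₁(i)` for `1 ≤ i ≤ n`) are weak
half-plane walks from depth `0` (`x₁(i) ≥ 0` for `i ≤ n`). -/
theorem halfSpaceWalks_subset (n : ℕ) : Zd.halfSpaceWalks 2 n ⊆ hpWalks 0 n := by
  intro ω hω
  rw [Zd.mem_halfSpaceWalks] at hω
  obtain ⟨hs, hh⟩ := hω
  rw [hpWalks, Finset.mem_filter]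
  refine ⟨hs, fun i hi => ?_⟩
  have h0 : ω 0 = 0 := (Zd.mem_saws.1 hs).1
  rcases Nat.eq_zero_or_pos i with rfl | hpos
  · simp [h0]
  · have h1 := (hh i hpos hi).le
    rw [h0, Pi.zero_apply] at h1
    simpa using h1

/-- `halfPlanePartialSum N ≤ H_N`. -/
theorem halfPlanePartialSum_le_hpSum (N : ℕ) :
    AnnularMassDecay.Negative.halfPlanePartialSum N ≤
      ∑ n ∈ Finset.range (N + 1), ((hpWalks 0 n).card : ℝ) * criticalFugacity ^ n := by
  refine Finset.sum_le_sum fun n _ => ?_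
  have h : Zd.halfSpaceCount 2 n ≤ (hpWalks 0 n).card :=
    Finset.card_le_card (halfSpaceWalks_subset n)
  exact mul_le_mul_of_nonneg_right (by exact_mod_cast h) (pow_nonneg criticalFugacity_pos.le n)

/-- **Divergence**: the partial sums `H_N` are unbounded (Madras–Slade Corollary 3.1.8, via the
tree's `halfPlanePartialSum_unbounded`). -/
theorem hpSum_unbounded (B : ℝ) :
    ∃ N, B ≤ ∑ n ∈ Finset.range (N + 1), ((hpWalks 0 n).card : ℝ) * criticalFugacity ^ n := by
  obtain ⟨K, hK⟩ := AnnularMassDecay.Negative.halfPlanePartialSum_unbounded B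
  exact ⟨K, hK.le.trans (halfPlanePartialSum_le_hpSum K)⟩

/-- `H^{(t)}_N` is monotone in `N`. -/
theorem hpSum_mono (t : ℕ) {K M : ℕ} (h : K ≤ M) :
    ∑ n ∈ Finset.range (K + 1), ((hpWalks t n).card : ℝ) * criticalFugacity ^ n ≤
      ∑ n ∈ Finset.range (M + 1), ((hpWalks t n).card : ℝ) * criticalFugacity ^ n :=
  Finset.sum_le_sum_of_subset_of_nonneg (Finset.range_mono (by omega)) fun _ _ _ =>
    mul_nonneg (Nat.cast_nonneg _) (pow_nonneg criticalFugacity_pos.le _)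

/-! ### The wall-bridge mass floor -/

/-- **`1 ≤ 2 A (R+2)^C W_N` for some `N`**: pick `N ≥ N₀(R+1)` with `H_N ≥ 2S + 2`; then
`H_N ≤ S + W_N A (R+2)^C H_N` and `H_N − S ≥ H_N / 2`. -/
theorem wallSum_floor (hcut : HalfPlaneCut) (hslab : SlabSubcritical) {A C : ℝ}
    (hprof : ∀ t : ℕ, ∃ N₀ : ℕ, ∀ N : ℕ, N₀ ≤ N →
      ∑ n ∈ Finset.range (N + 1), ((hpWalks t n).card : ℝ) * criticalFugacity ^ n ≤
        A * ((t : ℝ) + 1) ^ C *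
          ∑ n ∈ Finset.range (N + 1), ((hpWalks 0 n).card : ℝ) * criticalFugacity ^ n) (R : ℕ) :
    ∃ N : ℕ, 1 ≤ 2 * A * ((R : ℝ) + 2) ^ C *
      ∑ k ∈ Finset.range (N + 1), ((wallBridges R k).card : ℝ) * criticalFugacity ^ k := by
  have hx : 0 ≤ criticalFugacity := criticalFugacity_pos.le
  obtain ⟨S, hS⟩ := hslab R
  obtain ⟨N₀, hN₀⟩ := hprof (R + 1)
  obtain ⟨N₁, hN₁⟩ := hpSum_unbounded (2 * S + 2)
  obtain ⟨N, hN0, hN1⟩ : ∃ N, N₀ ≤ N ∧ N₁ ≤ N := ⟨max N₀ N₁, le_max_left _ _, le_max_right _ _⟩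
  refine ⟨N, ?_⟩
  have hS0 : 0 ≤ S :=
    le_trans (Finset.sum_nonneg fun n _ => mul_nonneg (Nat.cast_nonneg _) (pow_nonneg hx n)) (hS 0)
  -- `2S + 2 ≤ H_N`, so `H_N > 0`
  have hHN := hN₁.trans (hpSum_mono 0 hN1)
  have hpos := lt_of_lt_of_le (by linarith : (0 : ℝ) < 2 * S + 2) hHN
  -- `H^{(R+1)}_N ≤ A (R+2)^C H_N`
  have hprofN := hN₀ N hN0
  have hc : (((R + 1 : ℕ) : ℝ) + 1) = (R : ℝ) + 2 := by push_cast; ring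
  rw [hc] at hprofN
  have hW0 : 0 ≤ ∑ k ∈ Finset.range (N + 1), ((wallBridges R k).card : ℝ) * criticalFugacity ^ k :=
    Finset.sum_nonneg fun k _ => mul_nonneg (Nat.cast_nonneg _) (pow_nonneg hx k)
  -- `H_N ≤ S + W_N (A (R+2)^C H_N)`
  have h1 := (hpSum_le hcut R N).trans (add_le_add (hS N) (mul_le_mul_of_nonneg_left hprofN hW0))
  refine le_of_mul_le_mul_left ?_ hpos
  linarith

/-! ### Prepending one east step: wall bridges of span `R+1` are bridges of span `R+2` -/

/-- **Prepending one east step** (`Zd.concatWalk 1 (Zd.straightWalk 2 1)`, via the tree's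
`LiebSimonStar.Hardness.pre_*` lemmas) maps `wallBridges R k` injectively into the bridges of
`Zd.bridges 2 (k+1)` whose last vertex lies on the column `x = R + 2` (Madras–Slade Definition
1.2.4: `0 = x₁(0) < x₁(i) ≤ x₁(k+1) = R + 2`); hence
`w_k = #wallBridges R k ≤ #{β ∈ Zd.bridges 2 (k+1) | β (k+1) ₀ = R + 2}`. -/
theorem card_wallBridges_le (R k : ℕ) :
    (wallBridges R k).card ≤
      ((Zd.bridges 2 (k + 1)).filter (fun β => β (k + 1) 0 = ((R + 2 : ℕ) : ℤ))).card := by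
  refine Finset.card_le_card_of_injOn (fun ω => Zd.concatWalk 1 (Zd.straightWalk 2 1) ω)
    (fun ω hω => ?_) (fun ω hω ω' hω' h => ?_)
  · rw [Finset.mem_coe, wallBridges, Finset.mem_filter] at hω
    rw [Finset.mem_coe, Finset.mem_filter]
    obtain ⟨hωs, hsl, hk⟩ := hω
    have hω0 : ω 0 = 0 := (Zd.mem_saws.1 hωs).1
    -- first-coordinate bounds along the wall bridge: `0 ≤ x₁(j) ≤ x₁(k) = R + 1`
    have hbd : ∀ j ≤ k, 0 ≤ ω j 0 ∧ ω j 0 ≤ ω k 0 := by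
      intro j hj
      rcases lt_or_eq_of_le hj with hj | rfl
      · exact ⟨(hsl j hj).1, (hsl j hj).2.trans (by rw [hk]; linarith)⟩
      · exact ⟨by rw [hk]; positivity, le_rfl⟩
    refine ⟨Zd.mem_bridges.2 ⟨?_, ?_⟩, ?_⟩
    · rw [add_comm]
      exact LiebSimonStar.Hardness.pre_mem_saws hωs fun j hj => (hbd j hj).1
    · rw [add_comm]
      exact LiebSimonStar.Hardness.pre_isBridge hωs hbd
    · show Zd.concatWalk 1 (Zd.straightWalk 2 1) ω (k + 1) 0 = ((R + 2 : ℕ) : ℤ)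
      rw [add_comm k 1, LiebSimonStar.Hardness.pre_apply_one_add_zero hω0, hk]
      push_cast
      ring
  · rw [Finset.mem_coe, wallBridges, Finset.mem_filter] at hω hω'
    exact LiebSimonStar.Hardness.pre_injective (Zd.mem_saws.1 hω.1).1 (Zd.mem_saws.1 hω'.1).1 h

/-- **`x_c · W_N ≤` the `x_c`-mass of the bridges of span `R+2` and length `≤ N+1`** (reindex
`n = k+1` and drop the `n = 0` term). -/
theorem mul_wallSum_le_bridgeSum (R N : ℕ) :
    criticalFugacity *
        ∑ k ∈ Finset.range (N + 1), ((wallBridges R k).card : ℝ) * criticalFugacity ^ k ≤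
      ∑ n ∈ Finset.range (N + 1 + 1),
        ∑ _ω ∈ (Zd.bridges 2 n).filter (fun ω => ω n 0 = ((R + 2 : ℕ) : ℤ)),
          criticalFugacity ^ n := by
  have hx : 0 ≤ criticalFugacity := criticalFugacity_pos.le
  obtain ⟨f, hf⟩ : ∃ f : ℕ → ℝ, f = fun n =>
      (((Zd.bridges 2 n).filter (fun ω => ω n 0 = ((R + 2 : ℕ) : ℤ))).card : ℝ) *
        criticalFugacity ^ n := ⟨_, rfl⟩
  have hf0 : ∀ n, 0 ≤ f n := fun n => by
    rw [hf]; exact mul_nonneg (Nat.cast_nonneg _) (pow_nonneg hx n)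
  calc criticalFugacity *
        ∑ k ∈ Finset.range (N + 1), ((wallBridges R k).card : ℝ) * criticalFugacity ^ k
      = ∑ k ∈ Finset.range (N + 1),
          ((wallBridges R k).card : ℝ) * criticalFugacity ^ (k + 1) := by
        rw [Finset.mul_sum]
        refine Finset.sum_congr rfl fun k _ => ?_
        rw [pow_succ]; ring
    _ ≤ ∑ k ∈ Finset.range (N + 1), f (k + 1) := by
        refine Finset.sum_le_sum fun k _ => ?_
        rw [hf]
        exact mul_le_mul_of_nonneg_right (by exact_mod_cast card_wallBridges_le R k)
          (pow_nonneg hx _)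
    _ ≤ ∑ k ∈ Finset.range (N + 1), f (k + 1) + f 0 := le_add_of_nonneg_right (hf0 0)
    _ = ∑ n ∈ Finset.range (N + 1 + 1), f n := (Finset.sum_range_succ' f (N + 1)).symm
    _ = _ := by simp only [hf, Finset.sum_const, nsmul_eq_mul]

end SpanFloorOfHalfPlaneCutProof

open SpanFloorOfHalfPlaneCutProof in
/-- **Stub `stub_spanFloor_of_halfPlaneCut`** (the by-product door of the line `profile-potential`):
the half-plane cut, slab subcriticality and the half-plane profile bound (exponent `C`, constant
`A ≥ 1`) imply Kesten's span-renewal floor `SpanRenewalFloor` with exponent `C` and constant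
`c = x_c / (2A)`.  See the module docstring for the proof. -/
theorem stub_spanFloor_of_halfPlaneCut :
    HalfPlaneCut → SlabSubcritical → HalfPlaneProfileBound → SpanRenewalFloor := by
  rintro hcut hslab ⟨A, C, hA, hC, hprof⟩
  have hx : 0 < criticalFugacity := criticalFugacity_pos
  have hA0 : 0 < A := by linarith
  refine ⟨C, criticalFugacity / (2 * A), hC, by positivity, fun L hL => ?_⟩
  rcases Nat.lt_or_ge L 2 with hL2 | hL2
  · -- `L = 1`: the one-step straight walk (landed: `Hardness.criticalFugacity_le_bridgeMass_one`)
    obtain rfl : L = 1 := by omega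
    refine ⟨1, ?_⟩
    have h1 : criticalFugacity / (2 * A) ≤ criticalFugacity := by
      rw [div_le_iff₀ (by positivity)]
      nlinarith
    calc criticalFugacity / (2 * A) * ((1 : ℕ) : ℝ) ^ (-C)
        = criticalFugacity / (2 * A) := by rw [Nat.cast_one, Real.one_rpow, mul_one]
      _ ≤ criticalFugacity := h1
      _ ≤ _ := LiebSimonStar.Hardness.criticalFugacity_le_bridgeMass_one
  · -- `L = R + 2`
    obtain ⟨R, rfl⟩ : ∃ R, L = R + 2 := ⟨L - 2, by omega⟩
    obtain ⟨N, hN⟩ := wallSum_floor hcut hslab hprof R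
    refine ⟨N + 1, ?_⟩
    have hcast : ((R + 2 : ℕ) : ℝ) = (R : ℝ) + 2 := by push_cast; ring
    rw [hcast, Real.rpow_neg (by positivity), ← div_eq_mul_inv, div_div,
      div_le_iff₀ (by positivity)]
    calc criticalFugacity
        ≤ criticalFugacity * (2 * A * ((R : ℝ) + 2) ^ C *
            ∑ k ∈ Finset.range (N + 1), ((wallBridges R k).card : ℝ) * criticalFugacity ^ k) := by
          nlinarith [mul_le_mul_of_nonneg_left hN hx.le]
      _ = criticalFugacity *
            (∑ k ∈ Finset.range (N + 1), ((wallBridges R k).card : ℝ) * criticalFugacity ^ k) *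
              (2 * A * ((R : ℝ) + 2) ^ C) := by ring
      _ ≤ _ := mul_le_mul_of_nonneg_right (mul_wallSum_le_bridgeSum R N) (by positivity)

end Summit.CriticalPhenomena.SAWScalingLimit.Theorems.TubeLowerBound.ProfilePotential

end
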